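import Literature.NumberTheory.LFunctions.AbelianFrobeniusDensity
import Literature.NumberTheory.LFunctions.RayClassLogEuler
import HarnessLib

/-!
# Strong Dirichlet density in terms of all primes

Topic `Literature/NumberTheory/LFunctions`; theorems only (no `sorry`, no new named fact, no new
definition), built on `AbelianFrobeniusDensity.lean` (`AbelianDensity.summable_npow_one_of_not_prime`:
`Σ_{N(v) not prime} N(v)⁻¹ < ∞`; `AbelianDensity.hasSum_primeTerm_fiberwise`: regrouping the
degree-one primes along the norm) and `PrimeLogDensity.lean` (`HasStrongDirichletDensity K Y d`, a
statement about the degree-one prime Dirichlet series `Σ_p #{v ∈ Y : N v = p} p^{-s}`):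

* `exists_tendsto_tsum_not_prime` — the degree `≥ 2` part `Σ_{N(v) not prime} c(v) N(v)^{-s}` of
  a prime sum with bounded coefficients converges as `s → 1⁺` (Tannery);
* `primeSeries_primeNormCount_eq` — the degree-one counting series of `Y` as a sum over the primes
  of `K` of prime norm;
* `hasStrongDirichletDensity_iff_tendsto` — **`Y` has strong Dirichlet density `d` iff
  `Σ_{v ∈ Y} N(v)^{-s} + d log(s - 1)` converges as `s → 1⁺`** (all primes of `K`, complex
  values: the currency of `log L`-arguments; Heilbronn, Ch. VIII of Cassels–Fröhlich, §2, PDF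
  p. 251: the primes of degree `≥ 2` "are `O(x^{1/2})` in number"; Neukirch VII, proof of (13.2)).

Used by `GaloisRepresentations/CyclotomicDirichletDensity.lean` (Dirichlet's theorem for
`K(ζ_m)/K` from Heilbronn's (b)).

## References

* H. Heilbronn, *Zeta-functions and L-functions*, Ch. VIII of Cassels–Fröhlich (1967), §2
  (PDF p. 251). [HeilbronnZetaL1967]
* J. Neukirch, *Algebraic Number Theory* (1999), VII (13.1)–(13.2). [NeukirchANT1999]
-/

noncomputable section

open Filter NumberField IsDedekindDomain

open scoped _root_.Topology Classical

namespace Literature.NumberTheory.LFunctions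

variable {K : Type*} [Field K] [NumberField K]

/-- `AbelianDensity.npow v s = N(v)^{-s}` as a complex power. [folklore] -/
theorem ofReal_npow (v : HeightOneSpectrum (𝓞 K)) (s : ℝ) :
    ((AbelianDensity.npow v s : ℝ) : ℂ) = ((Ideal.absNorm v.asIdeal : ℕ) : ℂ) ^ (-(s : ℂ)) := by
  rw [AbelianDensity.npow, Complex.ofReal_cpow (Nat.cast_nonneg _)]
  push_cast
  rfl

/-- **The degree `≥ 2` part of a prime Dirichlet series with bounded coefficients converges as
`s → 1⁺`** (dominated convergence against `Σ_{N(v) not prime} N(v)⁻¹`). [folklore] -/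
theorem exists_tendsto_tsum_not_prime {c : HeightOneSpectrum (𝓞 K) → ℂ}
    (hc : ∀ v, ‖c v‖ ≤ 1) :
    ∃ A : ℂ, Tendsto (fun s : ℝ => ∑' v : HeightOneSpectrum (𝓞 K),
      if (Ideal.absNorm v.asIdeal).Prime then (0 : ℂ)
        else c v * ((Ideal.absNorm v.asIdeal : ℕ) : ℂ) ^ (-(s : ℂ)))
      (𝓝[>] (1 : ℝ)) (𝓝 A) := by
  set g : ℝ → HeightOneSpectrum (𝓞 K) → ℂ := fun s v =>
    if (Ideal.absNorm v.asIdeal).Prime then (0 : ℂ)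
      else c v * ((Ideal.absNorm v.asIdeal : ℕ) : ℂ) ^ (-(s : ℂ)) with hgdef
  refine ⟨∑' v, g 1 v, tendsto_tsum_of_dominated_convergence AbelianDensity.summable_npow_one_of_not_prime
    (fun v => ?_) ?_⟩
  · -- termwise continuity
    refine tendsto_nhdsWithin_of_tendsto_nhds (ContinuousAt.tendsto ?_)
    by_cases h : (Ideal.absNorm v.asIdeal).Prime
    · simp only [h, if_true]
      exact continuousAt_const
    · simp only [h, if_false]
      exact (continuous_mul_absNorm_cpow v (c v)).continuousAt
  · filter_upwards [self_mem_nhdsWithin] with s hs v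
    by_cases h : (Ideal.absNorm v.asIdeal).Prime
    · simp only [h, if_true, norm_zero]
      exact le_rfl
    · simp only [h, if_false]
      refine (norm_mul_absNorm_cpow_le v (hc v) s).trans ?_
      exact absNorm_rpow_neg_le_rpow_neg v (le_of_lt hs)

/-- **The degree-one counting series as a sum over primes of `K`**: for `s > 1`,
`Σ_p #{v ∈ Y : N v = p} p^{-s} = Σ_{v ∈ Y, N(v) prime} N(v)^{-s}`
(`AbelianDensity.hasSum_primeTerm_fiberwise` with the indicator of `Y`). [folklore] -/
theorem primeSeries_primeNormCount_eq (Y : Set (HeightOneSpectrum (𝓞 K))) {s : ℝ} (hs : 1 < s) :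
    ((primeSeries (fun p => (primeNormCount K Y p : ℝ)) s : ℝ) : ℂ) =
      ∑' v : HeightOneSpectrum (𝓞 K), (if (Ideal.absNorm v.asIdeal).Prime then
        (if v ∈ Y then ((Ideal.absNorm v.asIdeal : ℕ) : ℂ) ^ (-(s : ℂ)) else 0) else 0) := by
  set a : HeightOneSpectrum (𝓞 K) → ℂ := fun v => if v ∈ Y then 1 else 0 with hadef
  have ha : ∀ v, ‖a v‖ ≤ 1 := fun v => by
    rw [hadef]
    simp only
    split_ifs <;> simp
  have h := (AbelianDensity.hasSum_primeTerm_fiberwise ha hs).tsum_eq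
  have hterm : ∀ v : HeightOneSpectrum (𝓞 K), AbelianDensity.primeTerm a s v =
      (if (Ideal.absNorm v.asIdeal).Prime then
        (if v ∈ Y then ((Ideal.absNorm v.asIdeal : ℕ) : ℂ) ^ (-(s : ℂ)) else 0) else 0) := by
    intro v
    rw [AbelianDensity.primeTerm, AbelianDensity.zterm, ofReal_npow, hadef]
    simp only
    split_ifs <;> simp
  rw [← tsum_congr hterm, ← h, primeSeries, Complex.ofReal_tsum]
  refine tsum_congr fun p => ?_
  rw [primeNormCount_eq_sum_indicator]
  push_cast
  congr 1
  refine Finset.sum_congr rfl fun v _ => ?_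
  rw [hadef]
  simp only [Set.indicator_apply]
  split_ifs <;> simp

/-- A family bounded by `N(v)^{-s}` (`s > 1`) is summable. [folklore] -/
theorem summable_of_norm_le_absNorm_rpow {f : HeightOneSpectrum (𝓞 K) → ℂ} {s : ℝ} (hs : 1 < s)
    (hf : ∀ v, ‖f v‖ ≤ ((Ideal.absNorm v.asIdeal : ℕ) : ℝ) ^ (-s)) : Summable f :=
  Summable.of_norm ((summable_absNorm_rpow_neg hs).of_nonneg_of_le (fun _ => norm_nonneg _) hf)

/-- **Strong Dirichlet density in terms of all primes**: `Y` has strong Dirichlet density `d`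
iff `Σ_{v ∈ Y} N(v)^{-s} + d log (s - 1)` converges as `s → 1⁺` (the primes of degree `≥ 2`
contribute a convergent term; Neukirch VII, proof of (13.2); Heilbronn §2, PDF p. 251).
[folklore] -/
theorem hasStrongDirichletDensity_iff_tendsto (Y : Set (HeightOneSpectrum (𝓞 K))) (d : ℝ) :
    HasStrongDirichletDensity K Y d ↔ ∃ A : ℂ, Tendsto (fun s : ℝ =>
      (∑' v : HeightOneSpectrum (𝓞 K),
        (if v ∈ Y then ((Ideal.absNorm v.asIdeal : ℕ) : ℂ) ^ (-(s : ℂ)) else 0)) +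
          d * Real.log (s - 1)) (𝓝[>] (1 : ℝ)) (𝓝 A) := by
  -- the degree `≥ 2` part converges
  obtain ⟨R, hR⟩ := exists_tendsto_tsum_not_prime (K := K)
    (c := fun v => if v ∈ Y then (1 : ℂ) else 0) (fun v => by split_ifs <;> simp)
  -- the decomposition of the all-prime series, for `s > 1`
  have hdec : ∀ s : ℝ, 1 < s →
      (∑' v : HeightOneSpectrum (𝓞 K),
        (if v ∈ Y then ((Ideal.absNorm v.asIdeal : ℕ) : ℂ) ^ (-(s : ℂ)) else 0)) =
      ((primeSeries (fun p => (primeNormCount K Y p : ℝ)) s : ℝ) : ℂ) +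
        ∑' v : HeightOneSpectrum (𝓞 K), (if (Ideal.absNorm v.asIdeal).Prime then (0 : ℂ)
          else (if v ∈ Y then (1 : ℂ) else 0) *
            ((Ideal.absNorm v.asIdeal : ℕ) : ℂ) ^ (-(s : ℂ))) := by
    intro s hs
    rw [primeSeries_primeNormCount_eq Y hs]
    have hB : Summable fun v : HeightOneSpectrum (𝓞 K) =>
        (if (Ideal.absNorm v.asIdeal).Prime then
          (if v ∈ Y then ((Ideal.absNorm v.asIdeal : ℕ) : ℂ) ^ (-(s : ℂ)) else 0) else 0) := by
      refine summable_of_norm_le_absNorm_rpow hs fun v => ?_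
      split_ifs
      · rw [norm_natCast_cpow_neg_ofReal (absNorm_heightOneSpectrum_pos v)]
      · rw [norm_zero]; positivity
      · rw [norm_zero]; positivity
    have hC : Summable fun v : HeightOneSpectrum (𝓞 K) =>
        (if (Ideal.absNorm v.asIdeal).Prime then (0 : ℂ)
          else (if v ∈ Y then (1 : ℂ) else 0) *
            ((Ideal.absNorm v.asIdeal : ℕ) : ℂ) ^ (-(s : ℂ))) := by
      refine summable_of_norm_le_absNorm_rpow hs fun v => ?_
      split_ifs
      · rw [norm_zero]; positivity
      · rw [one_mul, norm_natCast_cpow_neg_ofReal (absNorm_heightOneSpectrum_pos v)]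
      · rw [zero_mul, norm_zero]; positivity
    rw [← hB.tsum_add hC]
    refine tsum_congr fun v => ?_
    split_ifs <;> simp
  constructor
  · rintro ⟨L, hL⟩
    refine ⟨(L : ℂ) + R, ?_⟩
    have h1 : Tendsto (fun s : ℝ => (((primeSeries (fun p => (primeNormCount K Y p : ℝ)) s +
        d * Real.log (s - 1) : ℝ) : ℂ))) (𝓝[>] (1 : ℝ)) (𝓝 (L : ℂ)) :=
      (Complex.continuous_ofReal.tendsto L).comp hL
    refine (h1.add hR).congr' ?_
    filter_upwards [self_mem_nhdsWithin] with s hs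
    rw [hdec s hs]
    push_cast
    ring
  · rintro ⟨A, hA⟩
    refine ⟨(A - R).re, ?_⟩
    have h1 : Tendsto (fun s : ℝ => ((∑' v : HeightOneSpectrum (𝓞 K),
        (if v ∈ Y then ((Ideal.absNorm v.asIdeal : ℕ) : ℂ) ^ (-(s : ℂ)) else 0)) +
          d * Real.log (s - 1) -
        ∑' v : HeightOneSpectrum (𝓞 K), (if (Ideal.absNorm v.asIdeal).Prime then (0 : ℂ)
          else (if v ∈ Y then (1 : ℂ) else 0) *
            ((Ideal.absNorm v.asIdeal : ℕ) : ℂ) ^ (-(s : ℂ)))).re) (𝓝[>] (1 : ℝ))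
        (𝓝 (A - R).re) :=
      (Complex.continuous_re.tendsto _).comp (hA.sub hR)
    refine h1.congr' ?_
    filter_upwards [self_mem_nhdsWithin] with s hs
    rw [hdec s hs]
    rw [show ((((primeSeries (fun p => (primeNormCount K Y p : ℝ)) s : ℝ) : ℂ) +
        ∑' v : HeightOneSpectrum (𝓞 K), (if (Ideal.absNorm v.asIdeal).Prime then (0 : ℂ)
          else (if v ∈ Y then (1 : ℂ) else 0) * ((Ideal.absNorm v.asIdeal : ℕ) : ℂ) ^ (-(s : ℂ)))) +
        d * Real.log (s - 1) -
        ∑' v : HeightOneSpectrum (𝓞 K), (if (Ideal.absNorm v.asIdeal).Prime then (0 : ℂ)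
          else (if v ∈ Y then (1 : ℂ) else 0) * ((Ideal.absNorm v.asIdeal : ℕ) : ℂ) ^ (-(s : ℂ))))
        = (((primeSeries (fun p => (primeNormCount K Y p : ℝ)) s + d * Real.log (s - 1) : ℝ)) : ℂ)
        by push_cast; ring]
    exact Complex.ofReal_re _

end Literature.NumberTheory.LFunctions
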